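import Summits.BirchSwinnertonDyer.BirchSwinnertonDyer.Theorems.GenusKolyvaginAtTwoVisiblePairAtTwoDefs
import Literature.NumberTheory.QuadraticFields.KroneckerSplitting
import Literature.NumberTheory.EllipticCurves.TwoDescentLocalSelmerOfExhibit
import Literature.NumberTheory.EllipticCurves.TwoDescentLocalI0
import Literature.NumberTheory.EllipticCurves.TwoDescentLocalTwoCN
import Literature.NumberTheory.EllipticCurves.QuadraticTwistMinimalModelProofs
import Literature.NumberTheory.EllipticCurves.QuadraticTwistIntegralModel
import Literature.NumberTheory.DiophantineGeometry.MinimalDiscriminantProofs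
import Literature.NumberTheory.DiophantineGeometry.MinimalDiscriminantSmulProofs
import Literature.NumberTheory.Automorphic.BCDTModularitySemistableTwistProofs
import HarnessLib

/-!
# Route `GenusKolyvaginAtTwo`, LINE 6, KEY crux Q3 (inner statement of stmt-BirchSwinnertonDyer-22137):
# the Heegner hypothesis in LOCAL form — every split prime carries `√d_K ∈ ℚ_v`, every place where `d_K` is
# not a local square is a place of good reduction for `E` and for the twin `E^{(d_K)}` (off `d_K`)

Helper (seat `bsd-line-gk2-p3` g13; `--supports` the crux, closes nothing). The reductions of the displayed
Lemma-4.3 inputs of the pair instance (`…VisiblePairInputReductionsSplit`, p642024) leave ℚ-hypotheses only at the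
places `v` where `d_K` is NOT a square in `ℚ_v` and `v ∋ 2` or `v` is bad (for the member `E`), resp. `v ∋ 2`, `v`
bad for the twin, or `v ∣ d_K` (for `E^{(d_K)}`). This file turns the route's HEEGNER HYPOTHESIS
(`SatisfiesHeegnerHypothesis N K`: every `p ∣ N` has two primes of `𝓞 K` above it) into the local statements
that dispose of the "bad" branches:

* §1 `exists_sq_eq_discr_adicCompletion_of_ncard_primesOver_eq_two` — **a prime `p` that splits in the quadratic
  field `K` (`d_K` odd) has `√d_K ∈ ℚ_p`**: decomposition law (`KroneckerSplitting`: `(d_K/p) = 1`, resp.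
  `d_K ≡ 1 (mod 8)` at `p = 2`) + Hensel in the tree's `ℚ_p` square tests (`TwoDescentLocal`, Serre II §3.3).
* §2 `hasGoodReductionAt_of_heegner_of_not_exists_sq` — **on the Heegner habitat, a place where `d_K` is not a
  local square is a place of good reduction of `E`** (`p ∤ N ⟹` good, `BCDT.…of_not_dvd_conductorNorm`;
  `p ∣ N ⟹` split `⟹` square).
* §3 `hasGoodReductionAt_quadraticTwist_of_eq_one_add_four_mul` — **the twist `W.quadraticTwist d` by an integer
  `d = 1 + 4k` is good at every place `v ∤ d` where `W` is good, ALSO `v ∣ 2`** (integral twist model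
  `y² + a₁xy + a₃y = …`, Silverman VII.1.3; the tree's `ordMinimalDiscriminant_twistModel`, as in
  `AdditiveBranchIMCGreenbergVatsalResidualBranchGoodReduction` for `d = p ≡ 1 mod 4`); and
  `hasGoodReductionAt_twin_of_heegner_of_not_exists_sq` — the twin `E^{(d_K)}` is good at every `v ∤ d_K` where
  `d_K` is not a local square (`d_K` odd ⟹ `d_K ≡ 1 mod 4`).

Reading for the crux (pair descent at `2` over `ℚ`): with `…SelmerDescentSplit` (square places),
`…SelmerDescentTwoTorsion` (`v ∣ d_K`, DEF-free) and `…SelmerDescentInert` (good places `v ∤ d_K`, `d_K ≡ 1 mod 4`, any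
level) these statements discharge every residual ℚ-hypothesis of `Input.loc_c₁_fin` / `loc_c₂_fin` except the
`K`-statement and the arithmetic DEF-free condition (assembly in the sequel). THEOREMS ONLY (no definition, no
named fact, no `sorry`, standard axioms). BSD is not proved by any of this.

References: [GrossLMS1991] §3 (3.1) (Heegner hypothesis: every `p ∣ N` splits in `K`); [Gross1984] §3;
[Serre1973] Ch. II §3.3 Thm 3–4; [SilvermanAEC2009] VII.1 Prop. 1.3, VII.5 Prop. 5.1; [Kolyvagin1989Izv] §3.
-/

set_option autoImplicit false
set_option linter.dupNamespace false -- tree convention: `Summit.BirchSwinnertonDyer.BirchSwinnertonDyer.Theorems` (summit = sub-problem)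

noncomputable section

open scoped Classical

namespace Summit.BirchSwinnertonDyer.BirchSwinnertonDyer.Theorems.GenusExact.VisiblePairAtTwo

open WeierstrassCurve NumberField IsDedekindDomain Field Rat.HeightOneSpectrum
open Literature.NumberTheory.EllipticCurves Literature.NumberTheory.GaloisRepresentations
open Literature.NumberTheory.EllipticCurves.TwoDescentLocal
open Literature.NumberTheory.QuadraticFields.Quadratic

variable {K : Type} [Field K] [NumberField K]

/-! ## §1 Split primes carry `√d_K` locally (decomposition law + Hensel) -/

/-- **A prime that splits in the quadratic field `K` (`d_K` odd) has `√d_K ∈ ℚ_p`.** For the place `v` of `ℚ`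
with prime `p` under it: if `p` has two primes of `𝓞 K` above it, then `d_K` is a square in `ℚ_v`. Odd `p`:
`(d_K/p) = 1` (`ncard_primesOver_eq_two_iff_jacobiSym`), so `d_K` is a non-zero square mod `p` and Hensel lifts it
(`isSquare_ratCast_padic_of_qrBit_eq_zero`); `p = 2`: `d_K ≡ 1 (mod 8)` (`ncard_primesOver_two_eq_two_iff`) and
`isSquare_ratCast_padic_two_of_res8_eq_one`. [cite: Serre1973, Ch. II §3.3 Thm 3 and Thm 4]
[cite: GrossLMS1991, §3 (3.1)] -/
theorem exists_sq_eq_discr_adicCompletion_of_ncard_primesOver_eq_two (h2 : Module.finrank ℚ K = 2)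
    (hodd : Odd (NumberField.discr K)) (v : HeightOneSpectrum (𝓞 ℚ))
    (hsplit : ((Ideal.span {((primesEquiv v : ℕ) : ℤ)}).primesOver (𝓞 K)).ncard = 2) :
    ∃ s : v.adicCompletion ℚ, s ^ 2 = algebraMap ℚ (v.adicCompletion ℚ) (NumberField.discr K : ℤ) := by
  have hp : (primesEquiv v : ℕ).Prime := (primesEquiv v).2
  have hd0 : ((NumberField.discr K : ℤ) : ℚ) ≠ 0 := by exact_mod_cast NumberField.discr_ne_zero K
  have hodd' : ¬ (2 : ℤ) ∣ NumberField.discr K := by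
    rcases hodd with ⟨k, hk⟩; omega
  suffices h : IsSquare (algebraMap ℚ (v.adicCompletion ℚ) (NumberField.discr K : ℤ)) by
    obtain ⟨r, hr⟩ := h
    exact ⟨r, by rw [sq]; exact hr.symm⟩
  by_cases hp2 : (primesEquiv v : ℕ) = 2
  · -- `2` splits: `d_K ≡ 1 (mod 8)`, a square in `ℚ₂`
    haveI : Fact (Nat.Prime 2) := ⟨Nat.prime_two⟩
    have hsplit2 : ((Ideal.span {(2 : ℤ)}).primesOver (𝓞 K)).ncard = 2 := by
      rw [← hsplit, hp2, Nat.cast_ofNat]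
    have h8 : NumberField.discr K % 8 = 1 := (ncard_primesOver_two_eq_two_iff h2).mp hsplit2
    have hsq : IsSquare (((NumberField.discr K : ℤ) : ℚ) : ℚ_[2]) := by
      refine isSquare_ratCast_padic_two_of_res8_eq_one hd0 ?_ ?_
      · rw [padicValRat.of_int, padicValInt.eq_zero_of_not_dvd hodd']
        exact Even.zero
      · rw [res8_intCast_odd hodd]
        have h1 : ((NumberField.discr K : ℤ) : ZMod (2 ^ 3)) = ((1 : ℤ) : ZMod (2 ^ 3)) := by
          rw [ZMod.intCast_eq_intCast_iff']
          norm_num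
          omega
        rw [h1, Int.cast_one]
    exact isSquare_algebraMap_adicCompletion_of_padic' v hp2 hsq
  · -- odd `p` splits: `(d_K/p) = 1`, a non-zero square mod `p`, lifted by Hensel
    haveI : Fact (primesEquiv v : ℕ).Prime := ⟨hp⟩
    have hj : jacobiSym (NumberField.discr K) (primesEquiv v : ℕ) = 1 :=
      (ncard_primesOver_eq_two_iff_jacobiSym h2 hp hp2).mp hsplit
    have hpd : ¬ ((primesEquiv v : ℕ) : ℤ) ∣ NumberField.discr K := fun hd ↦ by
      rw [← jacobiSym.legendreSym.to_jacobiSym,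
        (legendreSym.eq_zero_iff (primesEquiv v : ℕ) _).mpr
          (by rwa [ZMod.intCast_zmod_eq_zero_iff_dvd])] at hj
      exact zero_ne_one hj
    have hsq : IsSquare (((NumberField.discr K : ℤ) : ℚ) : ℚ_[(primesEquiv v : ℕ)]) :=
      isSquare_ratCast_padic_of_qrBit_eq_zero (primesEquiv v : ℕ) hp2 hd0
        (by rw [padicValRat.of_int, padicValInt.eq_zero_of_not_dvd hpd]; exact Even.zero)
        (qrBit_intCast_of_jacobiSym_eq_one hj)
    exact isSquare_algebraMap_adicCompletion_of_padic' v rfl hsq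

/-! ## §2 On the Heegner habitat a place where `d_K` is not a local square is good for `E` -/

variable (W : WeierstrassCurve ℚ) [W.IsElliptic]

/-- **Heegner hypothesis, local form for `E`**: if every prime `p ∣ N_E` splits in `K` (`[K : ℚ] = 2`, `d_K` odd)
then at every place `v` where `d_K` is NOT a square in `ℚ_v` the curve `E` has GOOD reduction (`p_v ∣ N_E` would
make `p_v` split, hence `√d_K ∈ ℚ_v` by §1). [cite: GrossLMS1991, §3 (3.1)] [cite: SilvermanAEC2009, VII.5 Prop. 5.1] -/
theorem hasGoodReductionAt_of_heegner_of_not_exists_sq (h2 : Module.finrank ℚ K = 2)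
    (hodd : Odd (NumberField.discr K)) (hH : SatisfiesHeegnerHypothesis (W.conductorNorm ℤ) K)
    (v : HeightOneSpectrum (𝓞 ℚ))
    (hns : ¬ ∃ s : v.adicCompletion ℚ, s ^ 2 = algebraMap ℚ (v.adicCompletion ℚ) (NumberField.discr K : ℤ)) :
    W.HasGoodReductionAt v := by
  refine Literature.NumberTheory.Automorphic.BCDT.hasGoodReductionAt_ringOfIntegers_of_not_dvd_conductorNorm W v
    fun hpN ↦ hns ?_
  exact exists_sq_eq_discr_adicCompletion_of_ncard_primesOver_eq_two h2 hodd v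
    (hH _ (primesEquiv v).2 hpN)

/-! ## §3 The twin `E^{(d_K)}` is good off `d_K` wherever `E` is (`d_K ≡ 1 mod 4`, also at `2`) -/

omit [NumberField K] in
/-- **The twist by an integer `d = 1 + 4k` is good at every place `v ∤ d` where `W` is good — also at `v ∣ 2`.**
(`W.quadraticTwist d` is `ℚ`-isomorphic to the integral twist model `W.twistModel k`, whose minimal discriminant
exponent at `v` equals that of `W` when `k` is `v`-integral and `4k + 1` a `v`-unit: Silverman VII.1.3; the twist is
unramified at `v`.) [cite: SilvermanAEC2009, VII.1 Prop. 1.3 and VII.5 Prop. 5.1(a)] -/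
theorem hasGoodReductionAt_quadraticTwist_of_eq_one_add_four_mul {d k : ℤ} (hdk : d = 1 + 4 * k)
    (v : HeightOneSpectrum (𝓞 ℚ)) (hdv : ((d : ℤ) : 𝓞 ℚ) ∉ v.asIdeal) (hW : W.HasGoodReductionAt v) :
    (W.quadraticTwist (d : ℚ)).HasGoodReductionAt v := by
  haveI : (W.quadraticTwist (d : ℚ)).IsElliptic := by
    have hd0 : (d : ℚ) ≠ 0 := by
      intro h
      have : (d : ℤ) = 0 := by exact_mod_cast h
      exact hdv (by rw [this, Int.cast_zero]; exact v.asIdeal.zero_mem)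
    exact W.isElliptic_quadraticTwist hd0
  have hk4 : 4 * (k : ℚ) + 1 = (d : ℚ) := by rw [hdk]; push_cast; ring
  have hvk : v.valuation ℚ (k : ℚ) ≤ 1 := by
    rw [show ((k : ℚ)) = algebraMap (𝓞 ℚ) ℚ ((k : ℤ) : 𝓞 ℚ) by rw [map_intCast]]
    exact HeightOneSpectrum.valuation_le_one v _
  have hvd : v.valuation ℚ (4 * (k : ℚ) + 1) = 1 := by
    rw [hk4, show ((d : ℚ)) = algebraMap (𝓞 ℚ) ℚ ((d : ℤ) : 𝓞 ℚ) by rw [map_intCast],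
      HeightOneSpectrum.valuation_of_algebraMap]
    exact le_antisymm (HeightOneSpectrum.intValuation_le_one v _)
      (not_lt.mp fun h ↦ hdv ((HeightOneSpectrum.intValuation_lt_one_iff_mem v _).mp h))
  -- the integral twist model is a `ℚ`-model of `W^{(d)}`
  obtain ⟨C', -, hC'⟩ := W.exists_variableChange_twistModel_eq_quadraticTwist (k : ℚ)
  rw [hk4] at hC'
  have hV : W.quadraticTwist (d : ℚ) = C' • W.twistModel (k : ℚ) := hC'.symm
  have hord : (W.quadraticTwist (d : ℚ)).ordMinimalDiscriminant v = W.ordMinimalDiscriminant v := by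
    rw [hV, ordMinimalDiscriminant_smul_holds v (W.twistModel (k : ℚ)) C',
      ordMinimalDiscriminant_twistModel v W hvk hvd]
  have h0 : W.ordMinimalDiscriminant v = 0 :=
    (ordMinimalDiscriminant_eq_zero_iff_holds v W).mpr hW
  exact (ordMinimalDiscriminant_eq_zero_iff_holds v (W.quadraticTwist (d : ℚ))).mp (by rw [hord, h0])

/-- **Heegner hypothesis, local form for the twin `E^{(d_K)}`**: `[K : ℚ] = 2`, `d_K` odd, every `p ∣ N_E` split
in `K`; then at every place `v ∤ d_K` where `d_K` is not a square in `ℚ_v` the twin `twin W K = W.quadraticTwist d_K`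
has GOOD reduction (`E` is good there by §2; `d_K ≡ 1 (mod 4)` so the twist is unramified at `v`, §3 — in
particular at `v = 2` inert). [cite: GrossLMS1991, §3 (3.1)] [cite: SilvermanAEC2009, VII.1 Prop. 1.3] -/
theorem hasGoodReductionAt_twin_of_heegner_of_not_exists_sq (h2 : Module.finrank ℚ K = 2)
    (hodd : Odd (NumberField.discr K)) (hH : SatisfiesHeegnerHypothesis (W.conductorNorm ℤ) K)
    (v : HeightOneSpectrum (𝓞 ℚ)) (hdv : ((NumberField.discr K : ℤ) : 𝓞 ℚ) ∉ v.asIdeal)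
    (hns : ¬ ∃ s : v.adicCompletion ℚ, s ^ 2 = algebraMap ℚ (v.adicCompletion ℚ) (NumberField.discr K : ℤ)) :
    (twin W K).HasGoodReductionAt v := by
  have h4 : NumberField.discr K % 4 = 1 :=
    (TwinGrossPrimes.discr_emod_four_eq_one_and_squarefree_of_odd (K := K) h2 hodd).1
  have hdk : NumberField.discr K = 1 + 4 * (NumberField.discr K / 4) := by omega
  exact hasGoodReductionAt_quadraticTwist_of_eq_one_add_four_mul W hdk v hdv
    (hasGoodReductionAt_of_heegner_of_not_exists_sq W h2 hodd hH v hns)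

end Summit.BirchSwinnertonDyer.BirchSwinnertonDyer.Theorems.GenusExact.VisiblePairAtTwo

end
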